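import Literature.AlgebraicGeometry.HodgeTheory.DworkSexticPencilFamily
import Literature.AlgebraicGeometry.Motives.UniversalHypersurfaceBaseChart
import HarnessLib

/-!
# The parameter `ψ` as a chart of the base of the Dwork pencil: `D(ℂ) ≅ ℂ ∖ μ₆`

Family `hodge`, layer `Literature/AlgebraicGeometry/HodgeTheory` (namespace `DworkSextic`). Sequel to
`DworkSexticPencilFamily` (the pencil `π : 𝒳 → D = 𝔸¹ ∖ μ₆` as the specialised family `familySpz` along
`pencilSpz`). Written for the crux `GenericInvariantHodgeClasses` (stmt-HodgeConjecture-24129) of route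
`HodgeConjecture/DworkReflectionQuotients`: the analytic inputs of the Noether–Lefschetz argument
(holomorphy of the Hodge bundles along the pencil, the identity theorem on the base) are statements about
HOLOMORPHIC functions of the parameter `ψ`; to read them on the tree's carrier `D(ℂ)` (complex points of the
open subscheme `D ⊆ 𝔸¹` with the strong topology) one needs the coordinate `ψ` as a homeomorphism onto
`ℂ ∖ μ₆`.

* `DworkSextic.pencilParam t : ℂ` — the parameter `ψ = t(b)` of a complex point `t ∈ D(ℂ)` (value of the
  coefficient homomorphism on the variable `b`); `pencilParam_pencilPoint` (`= ψ` at `[F_ψ]`),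
  `pencilParam_pow_six_ne_one`, `pencilPoint_pencilParam` (`[F_{ψ(t)}] = t`);
* `pencilParam_eq_coeffVector` — `ψ(t) = −(1/6)·a_{(1,…,1)}(F_t)`, a coordinate of the coefficient chart of
  the base `U` of the universal sextic (`Motives/UniversalHypersurfaceBaseChart`), hence
  `continuous_pencilParam` (Serre, GAGA §2 n°5: regular functions are continuous in the strong topology);
* `continuous_pencilPoint` — `ψ ↦ [F_ψ]` is continuous on `{ψ | ψ⁶ ≠ 1}` (the coefficient vector of `F_ψ` is
  affine-linear in `ψ`; `D(ℂ) → U(ℂ) → ℂ^{462}` is a topological embedding: closed immersion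
  `AlgPoints.isEmbedding_map_of_isClosedImmersion` + `isEmbedding_coeffVector`);
* **`DworkSextic.pencilChart : D(ℂ) ≃ₜ {ψ : ℂ // ψ⁶ ≠ 1}`** and
  **`isOpenEmbedding_pencilParam : IsOpenEmbedding pencilParam`** (`D(ℂ) ↪ ℂ` open, image `ℂ ∖ μ₆`).

## References

* [Katz2009] N. M. Katz, Another look at the Dwork family, Progr. Math. 270 (2009), §3 (the base
  `𝔸¹[1/(λ^d − 1)]`).
* [SerreGAGA1956] J.-P. Serre, Géométrie algébrique et géométrie analytique, Ann. Inst. Fourier 6 (1956),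
  §2 n°5 (the analytic topology of an algebraic variety; `ℂⁿ = (𝔸ⁿ)^h`).
* [VoisinHodgeII2003] C. Voisin, Hodge Theory and Complex Algebraic Geometry II (2003), §6.2.1.
-/

noncomputable section

open CategoryTheory AlgebraicGeometry MvPolynomial
open _root_.Topology
open scoped BigOperators

namespace Literature.AlgebraicGeometry.HodgeTheory.DworkSextic

open Literature.AlgebraicGeometry.Motives Literature.AlgebraicGeometry.Motives.UniversalHypersurface
open Literature.AlgebraicGeometry.HodgeTheory.UniversalHypersurface

/-! ### §1 The parameter of a point -/

/-- **The parameter `ψ = t(b) ∈ ℂ` of a complex point `t` of the base `D = 𝔸¹ ∖ μ₆` of the Dwork pencil**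
(the value of its coefficient homomorphism `ℂ[b] → ℂ` on `b`). [cite: Katz2009, §3] -/
def pencilParam (t : AlgPoints (baseSpz ℂ 4 6 pencilSpz) ℂ) : ℂ :=
  pointAlgHomSpz ℂ 4 6 pencilSpz t (X ())

/-- The coefficient homomorphism of `t` is evaluation at its parameter. [cite: VoisinHodgeII2003, §6.2.1] -/
theorem pointAlgHomSpz_eq_evalAt (t : AlgPoints (baseSpz ℂ 4 6 pencilSpz) ℂ) :
    pointAlgHomSpz ℂ 4 6 pencilSpz t = evalAt (pencilParam t) :=
  MvPolynomial.algHom_ext fun u => by cases u; rw [aeval_X]; rfl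

variable {ψ : ℂ}

/-- The parameter of `[F_ψ]` is `ψ`. [cite: Katz2009, §3] -/
theorem pencilParam_pencilPoint (hψ : ψ ^ 6 ≠ 1) : pencilParam (pencilPoint hψ) = ψ := by
  have h := pointHomSpz_pencilPoint hψ
  have h2 := congrArg (fun f : CommRingCat.of (MvPolynomial Unit ℂ) ⟶ CommRingCat.of ℂ => f.hom (X ())) h
  simp only [CommRingCat.hom_ofHom, AlgHom.toRingHom_eq_coe, RingHom.coe_coe, aeval_X] at h2
  exact h2

/-- **`[F_{ψ(t)}] = t`**: the parameter recovers the point (every point is `[F_ψ]`,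
`exists_eq_pencilPoint`). [cite: Katz2009, §3] [cite: VoisinHodgeII2003, §6.2.1] -/
theorem pencilParam_pow_six_ne_one (t : AlgPoints (baseSpz ℂ 4 6 pencilSpz) ℂ) : pencilParam t ^ 6 ≠ 1 := by
  obtain ⟨ψ, hψ, rfl⟩ := exists_eq_pencilPoint t
  rwa [pencilParam_pencilPoint hψ]

/-- **`[F_{ψ(t)}] = t`**. [cite: Katz2009, §3] [cite: VoisinHodgeII2003, §6.2.1] -/
theorem pencilPoint_pencilParam (t : AlgPoints (baseSpz ℂ 4 6 pencilSpz) ℂ) :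
    pencilPoint (pencilParam_pow_six_ne_one t) = t := by
  obtain ⟨ψ, hψ, rfl⟩ := exists_eq_pencilPoint t
  exact pointOfFormSpz_eq_of_eq ℂ 4 6 pencilSpz _ _ _ _ _ _ (by rw [pencilParam_pencilPoint hψ])

/-- `pencilParam` is injective. [cite: Katz2009, §3] -/
theorem pencilParam_injective :
    Function.Injective (pencilParam : AlgPoints (baseSpz ℂ 4 6 pencilSpz) ℂ → ℂ) := by
  intro t t' h
  rw [← pencilPoint_pencilParam t, ← pencilPoint_pencilParam t']
  exact pointOfFormSpz_eq_of_eq ℂ 4 6 pencilSpz _ _ _ _ _ _ (by rw [h])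

/-! ### §2 Continuity: the parameter is a coordinate of the coefficient chart -/

/-- The all-ones exponent `(1,…,1)` has degree `6`, i.e. is an index of the coefficient space of sextic forms.
[folklore] -/
private theorem degree_sum_single_one : (∑ l : Fin 6, Finsupp.single l 1 : Fin (4 + 2) →₀ ℕ).degree = 6 := by
  rw [Finsupp.degree, map_sum]
  simp

/-- **`ψ(t) = −(1/6)·(the coefficient of `∏ xᵢ` in `F_t`)`**: the parameter is, up to the factor `−6`, the
coordinate `a_{(1,…,1)}` of the coefficient chart `U(ℂ) ↪ ℂ^{462}` at the image of `t` in the base of the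
universal sextic. [cite: VoisinHodgeII2003, §6.2.1] -/
theorem pencilParam_eq_coeffVector (t : AlgPoints (baseSpz ℂ 4 6 pencilSpz) ℂ) :
    pencilParam t = -(6 : ℂ)⁻¹ *
      coeffVector ℂ 4 6 (AlgPoints.map (toBaseSpz ℂ 4 6 pencilSpz) t)
        ⟨∑ l : Fin 6, Finsupp.single l 1, degree_sum_single_one⟩ := by
  classical
  rw [coeffVector_apply]
  change pencilParam t = -(6 : ℂ)⁻¹ * coeff _ (pointFormSpz ℂ 4 6 pencilSpz t)
  rw [coeff_pointFormSpz, ← pointAlgHomSpz_apply, pointAlgHomSpz_eq_evalAt, pencilSpz, aeval_X, pencilCoeff]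
  have hne : ¬ ∃ i : Fin 6, (∑ l : Fin 6, Finsupp.single l 1 : Fin (4 + 2) →₀ ℕ) = Finsupp.single i 6 := by
    rintro ⟨i, hi⟩
    obtain ⟨j, hj⟩ : ∃ j : Fin 6, j ≠ i := ⟨i + 1, by simp⟩
    have h := congrArg (fun f : Fin 6 →₀ ℕ => f j) hi
    rw [Finsupp.finsetSum_apply, Finset.sum_eq_single j (fun l _ hl => by
      rw [Finsupp.single_apply, if_neg hl]) (fun h => absurd (Finset.mem_univ j) h),
      Finsupp.single_eq_same, Finsupp.single_apply, if_neg hj.symm] at h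
    exact one_ne_zero h
  simp only [if_neg hne, if_true, map_mul, aeval_C, aeval_X, Algebra.algebraMap_self, RingHom.id_apply]
  ring

/-- **The parameter is continuous on `D(ℂ)`** (a regular function; strong topology).
[cite: SerreGAGA1956, §2 n°5] -/
theorem continuous_pencilParam :
    Continuous (pencilParam : AlgPoints (baseSpz ℂ 4 6 pencilSpz) ℂ → ℂ) := by
  have h : (pencilParam : AlgPoints (baseSpz ℂ 4 6 pencilSpz) ℂ → ℂ) = fun t => -(6 : ℂ)⁻¹ *
      coeffVector ℂ 4 6 (AlgPoints.map (toBaseSpz ℂ 4 6 pencilSpz) t)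
        ⟨∑ l : Fin 6, Finsupp.single l 1, degree_sum_single_one⟩ := funext pencilParam_eq_coeffVector
  rw [h]
  exact continuous_const.mul (((continuous_apply _).comp (continuous_coeffVector ℂ 4 6)).comp
    (AlgPoints.continuous_map _))

/-! ### §3 The chart `D(ℂ) ≃ ℂ ∖ μ₆` -/

/-- `φ = pencilSpz` is surjective (`b = φ(−a_{(1,…,1)}/6)`), so `D ⟶ U` is a closed immersion.
[cite: VoisinHodgeII2003, §6.2.1] -/
theorem pencilSpz_surjective : Function.Surjective pencilSpz := by
  classical
  have hX : pencilSpz (C (-(6 : ℂ)⁻¹) * X ⟨∑ l : Fin 6, Finsupp.single l 1, degree_sum_single_one⟩) = X () := by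
    have hne : ¬ ∃ i : Fin 6, (∑ l : Fin 6, Finsupp.single l 1 : Fin (4 + 2) →₀ ℕ) = Finsupp.single i 6 := by
      rintro ⟨i, hi⟩
      obtain ⟨j, hj⟩ : ∃ j : Fin 6, j ≠ i := ⟨i + 1, by simp⟩
      have h := congrArg (fun f : Fin 6 →₀ ℕ => f j) hi
      rw [Finsupp.finsetSum_apply, Finset.sum_eq_single j (fun l _ hl => by
        rw [Finsupp.single_apply, if_neg hl]) (fun h => absurd (Finset.mem_univ j) h),
        Finsupp.single_eq_same, Finsupp.single_apply, if_neg hj.symm] at h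
      exact one_ne_zero h
    rw [map_mul, pencilSpz, aeval_C, aeval_X, pencilCoeff]
    simp only [if_neg hne, if_true, ← mul_assoc, ← map_mul, algebraMap_eq]
    norm_num
  intro p
  refine ⟨MvPolynomial.aeval (fun _ : Unit => C (-(6 : ℂ)⁻¹) *
    X (⟨∑ l : Fin 6, Finsupp.single l 1, degree_sum_single_one⟩ : DegIndex 4 6)) p, ?_⟩
  have hcomp : pencilSpz.comp (MvPolynomial.aeval fun _ : Unit => C (-(6 : ℂ)⁻¹) *
      X (⟨∑ l : Fin 6, Finsupp.single l 1, degree_sum_single_one⟩ : DegIndex 4 6)) = AlgHom.id ℂ _ :=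
    MvPolynomial.algHom_ext fun u => by cases u; rw [AlgHom.comp_apply, aeval_X, hX, AlgHom.id_apply]
  exact congrArg (fun f : MvPolynomial Unit ℂ →ₐ[ℂ] MvPolynomial Unit ℂ => f p) hcomp

/-- The coefficient vector of the image in `U(ℂ)` of a point of `D(ℂ)` is that of its Dwork form:
`coeffVector (toBaseSpz t) m = (pencilCoeff m)(ψ(t))`. [cite: VoisinHodgeII2003, §6.2.1] -/
theorem coeffVector_map_toBaseSpz (t : AlgPoints (baseSpz ℂ 4 6 pencilSpz) ℂ) (m : DegIndex 4 6) :
    coeffVector ℂ 4 6 (AlgPoints.map (toBaseSpz ℂ 4 6 pencilSpz) t) m = evalAt (pencilParam t) (pencilCoeff m) := by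
  rw [coeffVector_apply]
  change coeff m.1 (pointFormSpz ℂ 4 6 pencilSpz t) = _
  rw [coeff_pointFormSpz, ← pointAlgHomSpz_apply, pointAlgHomSpz_eq_evalAt, pencilSpz, aeval_X]

/-- `ψ ↦ (pencilCoeff m)(ψ)` is continuous (a polynomial in `ψ`). [folklore] -/
private theorem continuous_evalAt_pencilCoeff (m : DegIndex 4 6) :
    Continuous fun ψ : ℂ => evalAt ψ (pencilCoeff m) := by
  classical
  unfold pencilCoeff
  split_ifs
  · simp only [map_one]; exact continuous_const
  · simp only [map_mul, aeval_C, aeval_X, Algebra.algebraMap_self, RingHom.id_apply]; fun_prop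
  · simp only [map_zero]; exact continuous_const

/-- **`ψ ↦ [F_ψ]` is continuous on `{ψ | ψ⁶ ≠ 1}`**: through the topological embedding
`D(ℂ) ↪ U(ℂ) ↪ ℂ^{462}` (closed immersion, then coefficient chart) it is the affine-linear map
`ψ ↦ (coefficients of F_ψ)`. [cite: SerreGAGA1956, §2 n°5] [cite: VoisinHodgeII2003, §6.2.1] -/
theorem continuous_pencilPoint :
    Continuous fun z : {ψ : ℂ // ψ ^ 6 ≠ 1} => pencilPoint z.2 := by
  haveI : IsClosedImmersion (toBaseSpz ℂ 4 6 pencilSpz).left :=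
    isClosedImmersion_toBaseSpz_left ℂ 4 6 pencilSpz pencilSpz_surjective
  have hE : IsEmbedding (fun t : AlgPoints (baseSpz ℂ 4 6 pencilSpz) ℂ =>
      coeffVector ℂ 4 6 (AlgPoints.map (toBaseSpz ℂ 4 6 pencilSpz) t)) :=
    (isEmbedding_coeffVector ℂ 4 6).comp (AlgPoints.isEmbedding_map_of_isClosedImmersion _)
  rw [hE.continuous_iff]
  have h : ((fun t : AlgPoints (baseSpz ℂ 4 6 pencilSpz) ℂ =>
      coeffVector ℂ 4 6 (AlgPoints.map (toBaseSpz ℂ 4 6 pencilSpz) t)) ∘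
        fun z : {ψ : ℂ // ψ ^ 6 ≠ 1} => pencilPoint z.2) =
      fun z m => evalAt z.1 (pencilCoeff m) := by
    funext z m
    rw [Function.comp_apply, coeffVector_map_toBaseSpz, pencilParam_pencilPoint]
  rw [h]
  exact continuous_pi fun m => (continuous_evalAt_pencilCoeff m).comp continuous_subtype_val

/-- **The chart `D(ℂ) ≃ₜ {ψ ∈ ℂ : ψ⁶ ≠ 1}`, `t ↦ ψ(t)`, `ψ ↦ [F_ψ]`.** [cite: Katz2009, §3]
[cite: SerreGAGA1956, §2 n°5] -/
def pencilChart : AlgPoints (baseSpz ℂ 4 6 pencilSpz) ℂ ≃ₜ {ψ : ℂ // ψ ^ 6 ≠ 1} where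
  toFun t := ⟨pencilParam t, pencilParam_pow_six_ne_one t⟩
  invFun z := pencilPoint z.2
  left_inv t := pencilPoint_pencilParam t
  right_inv z := Subtype.ext (pencilParam_pencilPoint z.2)
  continuous_toFun := continuous_pencilParam.subtype_mk _
  continuous_invFun := continuous_pencilPoint

/-- `pencilChart t = ψ(t)` as a complex number. [cite: Katz2009, §3] -/
@[simp]
theorem pencilChart_apply_val (t : AlgPoints (baseSpz ℂ 4 6 pencilSpz) ℂ) :
    (pencilChart t : ℂ) = pencilParam t := rfl

/-- `{ψ | ψ⁶ ≠ 1}` is open in `ℂ`. [folklore] -/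
private theorem isOpen_setOf_pow_six_ne_one : IsOpen {ψ : ℂ | ψ ^ 6 ≠ 1} :=
  isOpen_ne_fun (continuous_pow 6) continuous_const

/-- **The parameter `ψ : D(ℂ) → ℂ` is an open embedding** (a homeomorphism onto the open set
`ℂ ∖ μ₆`): the complex points of `D = 𝔸¹ ∖ μ₆` with the strong topology ARE the punctured plane.
[cite: SerreGAGA1956, §2 n°5] [cite: Katz2009, §3] -/
theorem isOpenEmbedding_pencilParam :
    IsOpenEmbedding (pencilParam : AlgPoints (baseSpz ℂ 4 6 pencilSpz) ℂ → ℂ) := by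
  have h : (pencilParam : AlgPoints (baseSpz ℂ 4 6 pencilSpz) ℂ → ℂ) =
      (Subtype.val : {ψ : ℂ // ψ ^ 6 ≠ 1} → ℂ) ∘ pencilChart := rfl
  rw [h]
  exact isOpen_setOf_pow_six_ne_one.isOpenEmbedding_subtypeVal.comp pencilChart.isOpenEmbedding

end Literature.AlgebraicGeometry.HodgeTheory.DworkSextic

end
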